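import Mathlib
import Literature.Analysis.FluidPDE.Tao2016AveragedNS.ShiftSetCascadeFlows
import Literature.Analysis.FluidPDE.Tao2016AveragedNS.ShiftSetCascadeFlux
import Literature.Analysis.FluidPDE.Tao2016AveragedNS.WeightedLatticeFlowsOn
import Summits.NavierStokesRegularity.NavierStokesRegularity.Theorems.TaoLadderRungTwoFlatCertificateGlueExistOn
import Summits.NavierStokesRegularity.NavierStokesRegularity.Theorems.TaoLadderRungTwoFlatCertificateGlueStepOn
import HarnessLib

/-!
# Certificate glue on a shift set `𝕊`, IV: A WINDOW CERTIFICATE GIVES FORMAT-A♭ GAP DATA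
  (`GapData₂On 𝕊 ∧ TailThin`) — helper for item stmt-NavierStokesRegularity-22987 `FlatGapCertificatesV2`,
  crux K_A♭ of route TaoLadderRungTwoFlat; cell harvest/h2-tao-ladder, p1 g13

THE GLUE THEOREM `gapData₂On_of_windowCertificate`. Fix an admissible shift set `𝕊` (nearest neighbour,
slot-closed, `(1,1,1) ∉ 𝕊`; e.g. `S`, `S♭`), a table `α` of the class `E(𝕊, R)`, a scale ratio `1+ε₀ > 1`, an
observable mode `i₀` and a one-shell datum `X₀`. A WINDOW CERTIFICATE consists of: a window `[-Kb, Ka]`, a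
window-supported predicate `Core` on states («the window part lies in the certified region»; FAT-Z,
theory-1 §27), sup bounds `M`, weights `w ≥ 1` (bounded behind, (T1)-growing and thin ahead), a radius `r`,
a contraction `ρ`, exponents `θ₀ < θ ≤ 1/2`, clocks `c₀ < c`, a slack `σ`, a wake envelope `Zb`/`Zf` and a
quiet-tail profile `ν, ϑ`, subject to finitely many families of SCALAR inequalities (the statics: frozen-wake
closing and wake-shift, tail-zone thinness/closing/slowness and quiet-shift, tameness), and THREE DYNAMICAL
CLAUSES ABOUT THE FINITE WINDOW SYSTEM ONLY — `hinside` (the `r`-fattened core sits strictly inside the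
`M`-box), `htrap` (trapping: an exact window trajectory with edge inputs under the tail bounds and window in
the closed `M`-box is in the OPEN `M`-box, up to time `c`) and `hland` (landing readout at some `τ₁ ≤ c₀`:
ratio `a ≥ (1+ε₀)^{-θ₀}` with slack, a core state matching the shifted rescaled window within `ρr`,
acceptance of the quiet new top shell, exit of the old bottom shell under the wake envelope). CONCLUSION:
`GapData₂On 𝕊 σ ε₀ i₀ α X₀ Z w r ρ θ₀ θ c₀ c env₀ ∧ TailThin ε₀ w r` for the FAT reference set
`Z = {z | Core z, wake under Zb, zero beyond Ka, bounded}` and the explicit epoch envelope `env₀` — hence,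
by `CertificateGlueOn.noGlobalCascadeOn_of_gapData₂On` (K_B on `𝕊` + restart supports, all PROVED),
Theorem-4.2-level blow-up of `α` at scale ratio `1+ε₀` from `X₀`. The three dynamical clauses are exactly
what a validated integration of the `m(Kb+Ka+1)`-dimensional window ODE with two interval-valued edge
inputs delivers (C⁰ enclosures only: no derivative/tube data, since robustness is K_B♭'s job).

Assembled from glue I–III (`exact_flow_bounds`, `exists_exact_flow_on_window`, `exact_flow_step`).

HONEST FRAMING: Tao-type MODEL lattices (Tao 2016 §4/§6 vocabulary, shift-set parametrised); the window
certificate is a HYPOTHESIS — no certificate is produced here and nothing is claimed about any particular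
table or about all small `ε₀`; nothing here is a statement about the Navier–Stokes equations.
-/

noncomputable section

-- the sub-problem namespace repeats the summit name by design (D-0017)
set_option linter.dupNamespace false

namespace Summit.NavierStokesRegularity.NavierStokesRegularity.Theorems

open Set Filter Topology MeasureTheory intervalIntegral Literature.Analysis.FluidPDE
  Literature.Analysis.FluidPDE.TaoCascade
open Summit.NavierStokesRegularity.NavierStokesRegularity.Theorems.GappedFrontRobustOn

namespace CertificateGlueOn

variable {m : ℕ} {𝕊 : Finset (ℤ × ℤ × ℤ)}

/-- **A WINDOW CERTIFICATE GIVES FORMAT-A♭ GAP DATA ON `𝕊`** (see the module docstring for the reading of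
the hypotheses; the conclusion is literally `GapData₂On 𝕊 … ∧ TailThin ε₀ w r` for the fat reference set
and the explicit epoch envelope). [cite: Tao2016AveragedNS, §6.3–6.4 Props. 6.4–6.5 (statement shape of a renormalisation certificate); §4 Lemma 4.1 (4.5), (4.8)–(4.10)] -/
theorem gapData₂On_of_windowCertificate (h𝕊 : IsNearestNeighbourSet 𝕊) (h𝕊c : IsSlotClosed 𝕊)
    (h111 : ((1 : ℤ), (1 : ℤ), (1 : ℤ)) ∉ 𝕊) {ε₀ R : ℝ} (hε : 0 < ε₀)
    {α : Fin m → Fin m → Fin m → ℤ × ℤ × ℤ → ℝ} (hα : InTableClassOn 𝕊 R α)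
    {Cα : ℝ} (hCα0 : 0 ≤ Cα) (hCα : ∀ i, ∑ i₁, ∑ i₂, ∑ μ ∈ 𝕊, |α i₁ i₂ i μ| ≤ Cα)
    {i₀ : Fin m} {X₀ : Fin m → ℝ}
    -- window, weights, radius, contraction, exponents, clocks, slack
    {Kb Ka : ℤ} (hKb : 0 ≤ Kb) (hKa : 1 ≤ Ka) {Core : (Fin m → ℤ → ℝ) → Prop} {M w : ℤ → ℝ}
    {r ρ θ₀ θ c₀ c σ : ℝ} (hr : 0 < r) (hρ : 0 ≤ ρ) (hρ1 : ρ < 1) (hθ₀ : 0 ≤ θ₀) (hθ₀θ : θ₀ < θ)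
    (hθ : θ ≤ 1 / 2) (hc₀ : 0 < c₀) (hc₀c : c₀ < c) (hσ : 0 < σ) (hw1 : ∀ k, 1 ≤ w k)
    {Mmax : ℝ} (hMmax : ∀ k, -Kb ≤ k → k ≤ Ka → M k ≤ Mmax)
    (hcore : ∀ z z' : Fin m → ℤ → ℝ, (∀ i k, -Kb ≤ k → k ≤ Ka → z i k = z' i k) → Core z → Core z')
    (hdatum : Core (datumState i₀ X₀))
    -- wake side
    {Zb Zf : ℤ → ℝ} {Zmin Dmax Ct : ℝ} (hZf : ∀ j, j ≤ -Kb → 0 < Zf j) (hZmin : 0 < Zmin)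
    (hZmin' : ∀ j, j < -Kb → Zmin ≤ Zf j) (hZb0 : ∀ j, j < -Kb → 0 ≤ Zb j)
    (hZbf : ∀ j, j < -Kb → Zb j + r / w j ≤ Zf j / 2) (hMZf : M (-Kb) ≤ Zf (-Kb))
    (hcloseB : ∀ j, j < -Kb →
      c * (8 * Cα * (1 + ε₀) ^ ((5 : ℝ) * j / 2) *
        max (Zf (j - 1)) (max (Zf j) (Zf (j + 1))) * max (Zf (j - 1)) (max (Zf j) (Zf (j + 1))) + 0) ≤
        Zf j / 2)
    (hDmax : ∀ j, j < -Kb →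
      c * (8 * Cα * (1 + ε₀) ^ ((5 : ℝ) * j / 2) *
        max (Zf (j - 1)) (max (Zf j) (Zf (j + 1))) * max (Zf (j - 1)) (max (Zf j) (Zf (j + 1)))) ≤ Dmax)
    (hshiftB : ∀ j, j < -Kb →
      (1 + ε₀) ^ θ₀ * (Zb j + r / w j + c * (8 * Cα * (1 + ε₀) ^ ((5 : ℝ) * j / 2) *
        max (Zf (j - 1)) (max (Zf j) (Zf (j + 1))) * max (Zf (j - 1)) (max (Zf j) (Zf (j + 1))))) ≤
        Zb (j - 1))
    (hCt : 0 ≤ Ct) (hZbt : ∀ j, j < -Kb → Zb j ≤ Ct * (1 + ε₀) ^ (-(j : ℝ)))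
    (hwt : ∀ k : ℤ, k ≤ 0 → w k ≤ Ct * (1 + ε₀) ^ (-(k : ℝ)))
    -- quiet side
    {ν : ℤ → ℝ} {ϑ νmax : ℝ}
    (hT1 : ∀ k : ℤ, Ka ≤ k → 2 * (1 + ε₀) ^ (k : ℝ) * w k ≤ w (k + 1))
    (hcoreTop : ∀ z, Core z → ∀ i, 4 * (w Ka * |z i Ka|) ≤ r)
    (hthin : ∀ K : ℤ, Ka + 1 ≤ K →
      (1 + ε₀) ^ ((5 : ℝ) * K / 2) * r * w (K - 1) ≤ ϑ * w (K - 2) ^ 2)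
    (hthinW : TailThin ε₀ w r)
    (hν : ∀ K : ℤ, Ka ≤ K → 0 ≤ ν K) (hνmax : ∀ K : ℤ, Ka ≤ K → ν K ≤ νmax)
    (hcloseA : ∀ K : ℤ, Ka + 1 ≤ K →
      2 * (Real.sqrt 2 * Real.sqrt (4 / 3 * m * (25 / 32 + 0 * (1 + ε₀) ^ ((2 : ℝ) * K))) /
          (2 * (1 + ε₀) ^ ((K - 1 : ℤ) : ℝ)) +
        coeffAbsOn (botShifts 𝕊) α * c * (ϑ / (1 + ε₀) ^ ((5 : ℝ) / 2)) * ν (K - 1) ^ 2) ≤ ν K)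
    (hslowA : ∀ K : ℤ, Ka + 1 ≤ K →
      (1 + ε₀) ^ ((5 : ℝ) * (K - 1 : ℤ) / 2) * coeffAbsOn (botShifts 𝕊) α * c *
        (ν (K - 1) * r / w (K - 2)) ≤ 1 / 2)
    (hMν : M Ka ≤ ν Ka * r / w (Ka - 1))
    (hshiftA : ∀ k : ℤ, Ka < k → ν (k + 1) * (1 + ε₀) ^ θ₀ ≤ ρ)
    -- the certificate's interior, trapping and landing clauses
    (hinside : ∀ (z S₀ : Fin m → ℤ → ℝ), Core z →
      (∀ i k, -Kb ≤ k → k ≤ Ka → w k * |S₀ i k - z i k| ≤ r) → ∀ i k, -Kb ≤ k → k ≤ Ka → |S₀ i k| < M k)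
    (htrap : ∀ (s : ℝ) (z : Fin m → ℤ → ℝ) (S : Fin m → ℤ → ℝ → ℝ), Core z → 0 < s → s ≤ c →
      (∀ i k, -Kb ≤ k → k ≤ Ka → w k * |S i k 0 - z i k| ≤ r) →
      (∀ i k, -Kb ≤ k → k ≤ Ka → ∀ u ∈ Icc 0 s,
        HasDerivWithinAt (S i k) (quadTermOn 𝕊 ε₀ α S i k u) (Icc 0 s) u) →
      (∀ i, ContinuousOn (S i (-Kb - 1)) (Icc 0 s)) → (∀ i, ContinuousOn (S i (Ka + 1)) (Icc 0 s)) →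
      (∀ i, ∀ u ∈ Icc 0 s, |S i (-Kb - 1) u| ≤ Zf (-Kb - 1)) →
      (∀ i, ∀ u ∈ Icc 0 s, |S i (Ka + 1) u| ≤ ν (Ka + 1) * r / w Ka) →
      (∀ i k, -Kb ≤ k → k ≤ Ka → ∀ u ∈ Icc 0 s, |S i k u| ≤ M k) →
        ∀ i k, -Kb ≤ k → k ≤ Ka → ∀ u ∈ Icc 0 s, |S i k u| < M k)
    (hland : ∀ (z : Fin m → ℤ → ℝ) (S : Fin m → ℤ → ℝ → ℝ), Core z →
      (∀ i k, -Kb ≤ k → k ≤ Ka → w k * |S i k 0 - z i k| ≤ r) →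
      (∀ i k, -Kb ≤ k → k ≤ Ka → ∀ u ∈ Icc 0 c₀,
        HasDerivWithinAt (S i k) (quadTermOn 𝕊 ε₀ α S i k u) (Icc 0 c₀) u) →
      (∀ i, ContinuousOn (S i (-Kb - 1)) (Icc 0 c₀)) → (∀ i, ContinuousOn (S i (Ka + 1)) (Icc 0 c₀)) →
      (∀ i, ∀ u ∈ Icc 0 c₀, |S i (-Kb - 1) u| ≤ Zf (-Kb - 1)) →
      (∀ i, ∀ u ∈ Icc 0 c₀, |S i (Ka + 1) u| ≤ ν (Ka + 1) * r / w Ka) →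
      (∀ i k, -Kb ≤ k → k ≤ Ka → ∀ u ∈ Icc 0 c₀, |S i k u| ≤ M k) →
        ∃ (τ₁ a : ℝ) (z' : Fin m → ℤ → ℝ), 0 < τ₁ ∧ τ₁ ≤ c₀ ∧ 0 < a ∧ (1 + ε₀) ^ (-θ₀) ≤ a ∧
          (1 + σ) * a ≤ |S i₀ 1 τ₁| ∧ Core z' ∧
          (∀ i k, -Kb ≤ k → k + 1 ≤ Ka → w k * |S i (1 + k) τ₁ / a - z' i k| ≤ ρ * r) ∧
          (∀ (i : Fin m) (v : ℝ), |v| ≤ ν (Ka + 1) * r / w Ka → w Ka * |v / a - z' i Ka| ≤ ρ * r) ∧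
          (∀ i, |S i (-Kb) τ₁| ≤ a * Zb (-Kb - 1)))
    -- the Banach-space weight of the existence theory
    {ω : ℤ → ℝ} {A D Ω : ℝ} (hω : WeightRatiosLEOn 𝕊 ε₀ ω A) (hA : 0 ≤ A)
    (hD : ∀ k : ℤ, (1 + (1 + ε₀) ^ ((10 : ℝ) * k)) / ω k ≤ D) (hΩ : 0 ≤ Ω)
    (hωlow : ∀ k, k ≤ Ka → ω k ≤ Ω) (hωhigh : ∀ k, Ka < k → ω k ≤ Ω * w (k - 1)) :
    GapData₂On 𝕊 σ ε₀ i₀ α X₀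
        {z : Fin m → ℤ → ℝ | Core z ∧ (∀ i j, j < -Kb → |z i j| ≤ Zb j) ∧
          (∀ i k, Ka < k → z i k = 0) ∧ ∃ C : ℝ, ∀ i k, |z i k| ≤ C}
        w r ρ θ₀ θ c₀ c
        (fun k => if k < -Kb then (1 / 2) * Zf k ^ 2
          else if Ka < k then (1 / 2) * (ν k * r / w (k - 1)) ^ 2 else (1 / 2) * M k ^ 2) ∧
      TailThin ε₀ w r := by
  have hq : 0 < 1 + ε₀ := by linarith
  have hr0 : 0 ≤ r := hr.le
  have hw : ∀ k, 0 < w k := fun k => lt_of_lt_of_le one_pos (hw1 k)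
  have hαc : IsCancellingCoeffOn 𝕊 α := hα.2.1
  have hα1 : ∀ i₁ i₂ i₃ μ, |α i₁ i₂ i₃ μ| ≤ 1 := abs_le_one_of_inTableClassOn hα
  have hKK : -Kb ≤ Ka := by omega
  -- abbreviations
  set Z : Set (Fin m → ℤ → ℝ) := {z : Fin m → ℤ → ℝ | Core z ∧ (∀ i j, j < -Kb → |z i j| ≤ Zb j) ∧
    (∀ i k, Ka < k → z i k = 0) ∧ ∃ C : ℝ, ∀ i k, |z i k| ≤ C} with hZ
  -- window amplitudes of core states are bounded by `M`
  have hcoreM : ∀ z, Core z → ∀ i k, -Kb ≤ k → k ≤ Ka → |z i k| < M k := fun z hz i k h1 h2 =>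
    hinside z z hz (fun i k _ _ => by simp [hr0]) i k h1 h2
  have hMmax0 : 0 ≤ Mmax := by
    have := hcoreM _ hdatum i₀ Ka hKK le_rfl
    exact ((abs_nonneg _).trans this.le).trans (hMmax Ka hKK le_rfl)
  refine ⟨⟨⟨hr, hρ, hρ1, hθ₀, hθ₀θ, hθ, hc₀, hc₀c, hw1, ?_, ?_, ?_, ?_⟩, hσ, ?_, ?_, ?_⟩, hthinW⟩
  · -- the datum lies in `Z`
    refine ⟨hdatum, fun i j hj => ?_, fun i k hk => ?_, ?_⟩
    · rw [datumState_of_ne i₀ X₀ i (show j ≠ 0 by omega), abs_zero]; exact hZb0 j hj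
    · exact datumState_of_ne i₀ X₀ i (show k ≠ 0 by omega)
    · refine ⟨(∑ j, |X₀ j|) / |X₀ i₀|, fun i k => ?_⟩
      rw [datumState_apply]
      by_cases hk : k = 0
      · rw [if_pos hk, abs_div, abs_abs]
        exact div_le_div_of_nonneg_right
          (Finset.single_le_sum (fun j _ => abs_nonneg (X₀ j)) (Finset.mem_univ i)) (abs_nonneg _)
      · rw [if_neg hk, zero_div, abs_zero]
        exact div_nonneg (Finset.sum_nonneg fun j _ => abs_nonneg _) (abs_nonneg _)
  · -- the tail clause (T1), (T2) from `Ka + 1`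
    refine ⟨Ka + 1, fun k hk => ⟨hT1 k (by omega), fun z hz i => ?_⟩⟩
    obtain ⟨-, -, hz0, -⟩ := hz
    rw [hz0 i k (by omega), abs_zero, mul_zero, mul_zero]; exact hr0
  · -- (exist₀)
    intro S₀ hball
    obtain ⟨z, ⟨hzc, hzb, hza, C, hzC⟩, hballz⟩ := hball
    exact exists_exact_flow_on_window h𝕊 h𝕊c h111 hε hαc hα1 hCα0 hCα hKb hKa hr0 hw1
      (lt_trans hc₀ hc₀c) hMmax hZf hZmin hZmin' hZbf hMZf hcloseB hDmax (Za := fun _ => 0) hT1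
      (fun k _ => by simp [hr0]) hcoreTop hthin hν hνmax hcloseA hslowA hMν hinside htrap hω hA hD hΩ
      hωlow hωhigh hzc hzb (fun i k hk => by rw [hza i k hk, abs_zero]) hzC hballz
  · -- (step₀)
    intro S₀ τ S F hball hτ hflow
    obtain ⟨z, ⟨hzc, hzb, hza, -⟩, hballz⟩ := hball
    obtain ⟨τ₁, a, hstep, -⟩ := exact_flow_step h𝕊 h𝕊c h111 hε hαc hCα0 hCα hKb hKa hr hρ hw hc₀
      hc₀c.le hσ hcore hZf hZmin hZmin' hZbf hMZf hcloseB hshiftB hT1 hcoreTop hthin hν hcloseA hslowA hMν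
      hshiftA hinside htrap hland hzc hzb hza hballz hτ hflow
    exact ⟨τ₁, a, hstep⟩
  · -- TameBehind
    refine ⟨Ct + Mmax, fun z hz i k => ?_, fun k hk => ?_⟩
    · obtain ⟨hzc, hzb, hza, -⟩ := hz
      have hpow : 0 ≤ (1 + ε₀) ^ (-(k : ℝ)) := (Real.rpow_pos_of_pos hq _).le
      by_cases hk1 : k < -Kb
      · calc |z i k| ≤ Ct * (1 + ε₀) ^ (-(k : ℝ)) := (hzb i k hk1).trans (hZbt k hk1)
          _ ≤ (Ct + Mmax) * (1 + (1 + ε₀) ^ (-(k : ℝ))) := by nlinarith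
      · by_cases hk2 : Ka < k
        · rw [hza i k hk2, abs_zero]; positivity
        · push Not at hk1 hk2
          calc |z i k| ≤ Mmax := (hcoreM z hzc i k hk1 hk2).le.trans (hMmax k hk1 hk2)
            _ ≤ (Ct + Mmax) * (1 + (1 + ε₀) ^ (-(k : ℝ))) := by nlinarith
    · calc w k ≤ Ct * (1 + ε₀) ^ (-(k : ℝ)) := hwt k hk
        _ ≤ (Ct + Mmax) * (1 + ε₀) ^ (-(k : ℝ)) :=
          mul_le_mul_of_nonneg_right (by linarith) (Real.rpow_pos_of_pos hq _).le
  · -- StepSlackOn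
    intro S₀ τ S F hball hτ hflow
    obtain ⟨z, ⟨hzc, hzb, hza, -⟩, hballz⟩ := hball
    exact exact_flow_step h𝕊 h𝕊c h111 hε hαc hCα0 hCα hKb hKa hr hρ hw hc₀ hc₀c.le hσ hcore hZf hZmin
      hZmin' hZbf hMZf hcloseB hshiftB hT1 hcoreTop hthin hν hcloseA hslowA hMν hshiftA hinside htrap hland
      hzc hzb hza hballz hτ hflow
  · -- TailCompat from `Ka + 1`
    refine ⟨Ka + 1, νmax ^ 2 / 2, ϑ, fun k hk => ⟨hT1 k (by omega), fun z hz i => ?_, ?_, ?_⟩⟩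
    · obtain ⟨-, -, hz0, -⟩ := hz
      rw [hz0 i k (by omega), abs_zero, mul_zero, mul_zero]; exact hr0
    · -- the envelope at the shifted tolerance scale
      show (if k < -Kb then (1 / 2) * Zf k ^ 2
        else if Ka < k then (1 / 2) * (ν k * r / w (k - 1)) ^ 2 else (1 / 2) * M k ^ 2) ≤
        νmax ^ 2 / 2 * r ^ 2 / w (k - 1) ^ 2
      rw [if_neg (by omega), if_pos (by omega)]
      have hνk := hνmax k (by omega)
      have hνk0 := hν k (by omega)
      have hwk := hw (k - 1)
      have h1 : (ν k * r / w (k - 1)) ^ 2 = ν k ^ 2 * (r ^ 2 / w (k - 1) ^ 2) := by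
        field_simp
      have h2 : ν k ^ 2 ≤ νmax ^ 2 := pow_le_pow_left₀ hνk0 hνk 2
      have h3 : 0 ≤ r ^ 2 / w (k - 1) ^ 2 := by positivity
      rw [h1]
      have h4 : ν k ^ 2 * (r ^ 2 / w (k - 1) ^ 2) ≤ νmax ^ 2 * (r ^ 2 / w (k - 1) ^ 2) :=
        mul_le_mul_of_nonneg_right h2 h3
      have h5 : νmax ^ 2 / 2 * r ^ 2 / w (k - 1) ^ 2 = (1 / 2) * (νmax ^ 2 * (r ^ 2 / w (k - 1) ^ 2)) := by
        ring
      rw [h5]; linarith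
    · -- the upper growth bound from the thin-tail inequality at `K = k + 2`
      have h := hthin (k + 2) (by omega)
      have e1 : k + 2 - 1 = k + 1 := by ring
      have e2 : k + 2 - 2 = k := by ring
      rw [e1, e2] at h
      have e3 : (5 : ℝ) * (((k + 2 : ℤ) : ℤ) : ℝ) / 2 = (5 : ℝ) * ((k : ℝ) + 2) / 2 := by push_cast; ring
      rw [e3] at h
      exact h

end CertificateGlueOn

end Summit.NavierStokesRegularity.NavierStokesRegularity.Theorems

end
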